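import Mathlib
import HarnessLib

/-!
# Uniform `C¹` convergence under smooth post-composition; inverting `C¹`-perturbations of the identity

Two pieces of advanced-calculus plumbing used by perturbation arguments for intersections of
`J`-holomorphic curves (McDuff (1991), Lemma 4.3: "if `f'` is sufficiently `C¹`-close to `f` …";
`Literature/Geometry/Symplectic/SheetIntersectionPersist.lean`):

* `tendstoUniformlyOn_comp_of_isCompact` — if `Φ` is continuous on an open `U ⊇ K`, `K` compact
  (in a proper space), `f` maps `s` into `K` and `F n → f` uniformly on `s`, then
  `Φ ∘ F n → Φ ∘ f` uniformly on `s` (uniform continuity of `Φ` on a compact thickening of `K`).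
* `tendstoUniformlyOn_fderiv_comp_of_isCompact` — if moreover `Φ` is `C¹` on `U`, the `F n` are
  (eventually) differentiable on `s` with `fderiv (F n) → fderiv f` uniformly on `s` and
  `‖fderiv f‖` bounded on `s`, then also `fderiv (Φ ∘ F n) → fderiv (Φ ∘ f)` uniformly on `s`
  (chain rule and the splitting `DΦ(Fₙ) DFₙ - DΦ(f) Df = DΦ(Fₙ)(DFₙ - Df) + (DΦ(Fₙ) - DΦ(f)) Df`).
* `approximatesLinearOn_id_of_norm_fderiv_sub_id_le` — a differentiable map with
  `‖fderiv a z - id‖ ≤ c` on a convex set approximates the identity there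
  (`ApproximatesLinearOn`, mean value inequality);
* `exists_rightInverse_of_approximatesLinearOn_id` — such a map (with `c < 1`) on a ball
  `B(x, δ)` has a continuous right inverse defined on the closed ball
  `B̄(a x, (1 - c) δ / 2)` with values in `B(x, δ)` (Mathlib's inverse function theorem for
  `ApproximatesLinearOn`, `surjOn_closedBall_of_nonlinearRightInverse`).

## References

* D. McDuff, *The local behaviour of holomorphic curves in almost complex 4-manifolds*,
  J. Differential Geom. 34 (1991), Lemma 4.3. [McDuff1991LocalBehaviour]
-/

noncomputable section

open scoped Topology NNReal
open Set Function Metric Filter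

namespace Literature.Analysis.Calculus

section Composition

variable {X : Type*} {G G' : Type*} [NormedAddCommGroup G] [NormedSpace ℝ G] [ProperSpace G]
  [NormedAddCommGroup G'] [NormedSpace ℝ G']

omit [NormedSpace ℝ G] [NormedSpace ℝ G'] in
/-- **Uniform convergence is preserved by post-composition with a map continuous near a compact
set containing the limit's values.** [folklore] -/
theorem tendstoUniformlyOn_comp_of_isCompact {Φ : G → G'} {U K : Set G} (hU : IsOpen U)
    (hΦ : ContinuousOn Φ U) (hK : IsCompact K) (hKU : K ⊆ U) {F : ℕ → X → G} {f : X → G}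
    {s : Set X} (hfs : ∀ x ∈ s, f x ∈ K) (hF : TendstoUniformlyOn F f atTop s) :
    TendstoUniformlyOn (fun n x => Φ (F n x)) (fun x => Φ (f x)) atTop s := by
  obtain ⟨δ, hδ, hδU⟩ := hK.exists_cthickening_subset_open hU hKU
  have hK' : IsCompact (cthickening δ K) := hK.cthickening
  have hΦu : UniformContinuousOn Φ (cthickening δ K) :=
    hK'.uniformContinuousOn_of_continuous (hΦ.mono hδU)
  have hev : ∀ᶠ n in atTop, ∀ x ∈ s, F n x ∈ cthickening δ K := by
    filter_upwards [Metric.tendstoUniformlyOn_iff.1 hF δ hδ] with n hn x hx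
    exact mem_cthickening_of_dist_le _ (f x) _ _ (hfs x hx) (by rw [dist_comm]; exact (hn x hx).le)
  exact hΦu.comp_tendstoUniformlyOn_eventually hev
    (fun x hx => self_subset_cthickening _ (hfs x hx)) hF

variable [NormedAddCommGroup X] [NormedSpace ℝ X]

/-- **Uniform `C¹` convergence is preserved by post-composition with a `C¹` map** (near a compact
set containing the limit's values): the derivatives of `Φ ∘ F n` converge uniformly to those of
`Φ ∘ f` on `s`. [folklore] -/
theorem tendstoUniformlyOn_fderiv_comp_of_isCompact {Φ : G → G'} {U K : Set G} (hU : IsOpen U)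
    (hΦ : ContDiffOn ℝ 1 Φ U) (hK : IsCompact K) (hKU : K ⊆ U) {F : ℕ → X → G} {f : X → G}
    {s : Set X} (hfs : ∀ x ∈ s, f x ∈ K) (hF : TendstoUniformlyOn F f atTop s)
    (hdF : TendstoUniformlyOn (fun n x => fderiv ℝ (F n) x) (fun x => fderiv ℝ f x) atTop s)
    (hFd : ∀ᶠ n in atTop, ∀ x ∈ s, DifferentiableAt ℝ (F n) x)
    (hfd : ∀ x ∈ s, DifferentiableAt ℝ f x) {C : ℝ} (hC : ∀ x ∈ s, ‖fderiv ℝ f x‖ ≤ C) :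
    TendstoUniformlyOn (fun n x => fderiv ℝ (fun y => Φ (F n y)) x)
      (fun x => fderiv ℝ (fun y => Φ (f y)) x) atTop s := by
  obtain ⟨δ, hδ, hδU⟩ := hK.exists_cthickening_subset_open hU hKU
  set K' := cthickening δ K with hK'_def
  have hK' : IsCompact K' := hK.cthickening
  have hDΦc : ContinuousOn (fun y => fderiv ℝ Φ y) U := hΦ.continuousOn_fderiv_of_isOpen hU le_rfl
  have hDΦu : UniformContinuousOn (fun y => fderiv ℝ Φ y) K' :=
    hK'.uniformContinuousOn_of_continuous (hDΦc.mono hδU)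
  -- a bound `B` for `‖DΦ‖` on `K'`
  obtain ⟨B₀, hB₀⟩ := hK'.exists_bound_of_continuousOn (hDΦc.mono hδU)
  set B : ℝ := max B₀ 0 with hB_def
  have hB0 : 0 ≤ B := le_max_right _ _
  have hB : ∀ y ∈ K', ‖fderiv ℝ Φ y‖ ≤ B := fun y hy => (hB₀ y hy).trans (le_max_left _ _)
  set C' : ℝ := max C 0 with hC'_def
  have hC'0 : 0 ≤ C' := le_max_right _ _
  -- eventually the values `F n x` lie in `K'`
  have hev : ∀ᶠ n in atTop, ∀ x ∈ s, F n x ∈ K' := by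
    filter_upwards [Metric.tendstoUniformlyOn_iff.1 hF δ hδ] with n hn x hx
    exact mem_cthickening_of_dist_le _ (f x) _ _ (hfs x hx) (by rw [dist_comm]; exact (hn x hx).le)
  -- `DΦ (F n x) → DΦ (f x)` uniformly on `s`
  have hDΦF : TendstoUniformlyOn (fun n x => fderiv ℝ Φ (F n x)) (fun x => fderiv ℝ Φ (f x))
      atTop s :=
    hDΦu.comp_tendstoUniformlyOn_eventually hev
      (fun x hx => self_subset_cthickening _ (hfs x hx)) hF
  rw [Metric.tendstoUniformlyOn_iff] at hdF hDΦF ⊢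
  intro ε hε
  -- split `ε`: `B · ε₁ + ε₂ · C' < ε`
  set ε₁ : ℝ := ε / (2 * (B + 1)) with hε₁
  set ε₂ : ℝ := ε / (2 * (C' + 1)) with hε₂
  have hε₁0 : 0 < ε₁ := by positivity
  have hε₂0 : 0 < ε₂ := by positivity
  filter_upwards [hdF ε₁ hε₁0, hDΦF ε₂ hε₂0, hev, hFd] with n hn1 hn2 hn3 hn4 x hx
  -- chain rule for both compositions
  have hΦd : ∀ y ∈ K', DifferentiableAt ℝ Φ y := fun y hy =>
    (hΦ.differentiableOn one_ne_zero).differentiableAt (hU.mem_nhds (hδU hy))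
  have h1 : fderiv ℝ (fun y => Φ (F n y)) x = (fderiv ℝ Φ (F n x)).comp (fderiv ℝ (F n) x) :=
    fderiv_comp x (hΦd _ (hn3 x hx)) (hn4 x hx)
  have h2 : fderiv ℝ (fun y => Φ (f y)) x = (fderiv ℝ Φ (f x)).comp (fderiv ℝ f x) :=
    fderiv_comp x (hΦd _ (self_subset_cthickening _ (hfs x hx))) (hfd x hx)
  rw [h1, h2, dist_eq_norm]
  have hsplit : (fderiv ℝ Φ (f x)).comp (fderiv ℝ f x) - (fderiv ℝ Φ (F n x)).comp (fderiv ℝ (F n) x)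
      = (fderiv ℝ Φ (F n x)).comp (fderiv ℝ f x - fderiv ℝ (F n) x) +
        (fderiv ℝ Φ (f x) - fderiv ℝ Φ (F n x)).comp (fderiv ℝ f x) := by
    simp only [ContinuousLinearMap.comp_sub, ContinuousLinearMap.sub_comp]
    abel
  rw [hsplit]
  have hd1 := hn1 x hx
  have hd2 := hn2 x hx
  rw [dist_eq_norm] at hd1 hd2
  calc ‖(fderiv ℝ Φ (F n x)).comp (fderiv ℝ f x - fderiv ℝ (F n) x) +
        (fderiv ℝ Φ (f x) - fderiv ℝ Φ (F n x)).comp (fderiv ℝ f x)‖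
      ≤ ‖fderiv ℝ Φ (F n x)‖ * ‖fderiv ℝ f x - fderiv ℝ (F n) x‖ +
        ‖fderiv ℝ Φ (f x) - fderiv ℝ Φ (F n x)‖ * ‖fderiv ℝ f x‖ :=
        (norm_add_le _ _).trans (add_le_add (ContinuousLinearMap.opNorm_comp_le _ _)
          (ContinuousLinearMap.opNorm_comp_le _ _))
    _ ≤ B * ε₁ + ε₂ * C' := by
        have hCx : ‖fderiv ℝ f x‖ ≤ C' := (hC x hx).trans (le_max_left _ _)
        have hBx : ‖fderiv ℝ Φ (F n x)‖ ≤ B := hB _ (hn3 x hx)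
        have hn' : 0 ≤ ‖fderiv ℝ f x - fderiv ℝ (F n) x‖ := norm_nonneg _
        have hn'' : 0 ≤ ‖fderiv ℝ Φ (f x) - fderiv ℝ Φ (F n x)‖ := norm_nonneg _
        nlinarith [mul_le_mul hBx hd1.le hn' hB0, mul_le_mul hd2.le hCx (norm_nonneg _) hε₂0.le]
    _ < ε := by
        rw [hε₁, hε₂]
        have h3 : B * (ε / (2 * (B + 1))) ≤ ε / 2 := by
          rw [mul_div_assoc', div_le_div_iff₀ (by positivity) (by norm_num)]
          nlinarith
        have h4 : ε / (2 * (C' + 1)) * C' < ε / 2 := by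
          rw [div_mul_eq_mul_div, div_lt_div_iff₀ (by positivity) (by norm_num)]
          nlinarith
        linarith

end Composition

section Inverse

variable {E : Type*} [NormedAddCommGroup E] [NormedSpace ℝ E] [CompleteSpace E]

omit [CompleteSpace E] in
/-- **A differentiable map with `‖fderiv a z - id‖ ≤ c` on a convex set approximates the identity
there** (mean value inequality). [folklore] -/
theorem approximatesLinearOn_id_of_norm_fderiv_sub_id_le {a : E → E} {s : Set E}
    (hs : Convex ℝ s) (ha : ∀ z ∈ s, DifferentiableAt ℝ a z) {c : ℝ≥0}
    (hc : ∀ z ∈ s, ‖fderiv ℝ a z - ContinuousLinearMap.id ℝ E‖ ≤ c) :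
    ApproximatesLinearOn a ((ContinuousLinearEquiv.refl ℝ E : E ≃L[ℝ] E) : E →L[ℝ] E) s c := by
  intro x hx y hy
  have h := hs.norm_image_sub_le_of_norm_fderiv_le' ha hc hy hx
  simpa using h

/-- **Right inverse of a perturbation of the identity on a ball.** If `a` approximates the
identity on `B(x, δ)` with constant `c < 1`, then there is a map `φ`, continuous on the closed
ball `B̄(a x, (1 - c) (δ / 2))`, with `φ y ∈ B(x, δ)` and `a (φ y) = y` there (and `a` is
injective on `B(x, δ)`). [folklore] -/
theorem exists_rightInverse_of_approximatesLinearOn_id [Nontrivial E] {a : E → E} {x : E}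
    {δ : ℝ} (hδ : 0 < δ) {c : ℝ≥0} (hc : c < 1)
    (ha : ApproximatesLinearOn a ((ContinuousLinearEquiv.refl ℝ E : E ≃L[ℝ] E) : E →L[ℝ] E)
      (ball x δ) c) :
    InjOn a (ball x δ) ∧ ∃ φ : E → E, ContinuousOn φ (closedBall (a x) ((1 - c) * (δ / 2))) ∧
      ∀ y ∈ closedBall (a x) ((1 - c) * (δ / 2)), φ y ∈ ball x δ ∧ a (φ y) = y := by
  have hN : ‖((ContinuousLinearEquiv.refl ℝ E).symm : E →L[ℝ] E)‖₊ = 1 := by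
    rw [ContinuousLinearEquiv.refl_symm]
    exact ContinuousLinearMap.nnnorm_id
  have hc' : Subsingleton E ∨ c < ‖((ContinuousLinearEquiv.refl ℝ E).symm : E →L[ℝ] E)‖₊⁻¹ :=
    Or.inr (by rw [hN, inv_one]; exact hc)
  set e := ha.toOpenPartialHomeomorph a (ball x δ) hc' isOpen_ball with he
  have htarget : closedBall (a x) ((1 - c) * (δ / 2)) ⊆ e.target := by
    have h := ha.closedBall_subset_target hc' isOpen_ball (b := x) (ε := δ / 2) (by linarith)
      (closedBall_subset_ball (by linarith))
    rw [hN] at h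
    simpa [he, ApproximatesLinearOn.toOpenPartialHomeomorph_target] using h
  refine ⟨ha.injOn hc', e.symm, e.continuousOn_symm.mono htarget, fun y hy => ⟨?_, ?_⟩⟩
  · have := e.map_target (htarget hy)
    rwa [ApproximatesLinearOn.toOpenPartialHomeomorph_source] at this
  · exact e.right_inv (htarget hy)

end Inverse

end Literature.Analysis.Calculus

end
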